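import Summits.MatrixMultiplication.OmegaCensus.SmallFormats.MatMul22nRankGF7Slack5PatSound
import Summits.MatrixMultiplication.OmegaCensus.SmallFormats.MatMul22nRankGF7Slack6PatComplete
import Summits.MatrixMultiplication.OmegaCensus.SmallFormats.MatMul22nRankGF7Slack6PatCert1
import Summits.MatrixMultiplication.OmegaCensus.SmallFormats.MatMul22nRankGF7Slack6PatCert2
import Summits.MatrixMultiplication.OmegaCensus.SmallFormats.MatMul22nRankGF7Slack6PatCert3
import Summits.MatrixMultiplication.OmegaCensus.SmallFormats.MatMul22nRankGF7Slack6PatCert4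
import Summits.MatrixMultiplication.OmegaCensus.SmallFormats.MatMul22nRankGF7Slack6PatCert5
import Summits.MatrixMultiplication.OmegaCensus.SmallFormats.MatMul22nRankGF7Slack6PatCert6
import Summits.MatrixMultiplication.OmegaCensus.SmallFormats.MatMul22nRankGF7Slack6PatCert7
import Summits.MatrixMultiplication.OmegaCensus.SmallFormats.MatMul22nRankGF7Slack6PatCert8
import Summits.MatrixMultiplication.OmegaCensus.SmallFormats.MatMul22nRankGF7Slack6PatCert9
import Summits.MatrixMultiplication.OmegaCensus.SmallFormats.MatMul22nRankGF7Slack6PatCert10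
import Summits.MatrixMultiplication.OmegaCensus.SmallFormats.MatMul22nRankGF7Slack6PatCert11
import Summits.MatrixMultiplication.OmegaCensus.SmallFormats.MatMul22nRankGF7Slack6PatCert12
import Summits.MatrixMultiplication.OmegaCensus.SmallFormats.MatMul22nRankGF7Slack6PatCert13
import Summits.MatrixMultiplication.OmegaCensus.SmallFormats.MatMul22nRankGF7Slack6PatCert14
import HarnessLib

/-!
# ω-census family (a): every slack-6 pattern is a slot pattern (completeness of the 28 590 normalised slack-6 patterns; slot decomposition)

Cell `pub-omega` (unit `pub-omega-tensor-g18`), topic `Summits/MatrixMultiplication/OmegaCensus` (sub-folder `SmallFormats`).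
Framing (verbatim): lottery ticket; floor = certified bounds/negative ranges. HONEST FRAMING: kernel infrastructure, step P1 of
`pub-omega-tensor-g17/KERNEL-S6-DESIGN.md` (slack-6 analogue of the last section of `MatMul22nRankGF7Slack5PatSound`, whose generic part —
`pdfs5_sound`, `pcover5_sound` with `s ≤ 6` — is reused verbatim; generator `pub-omega-tensor-g17/code/gen6_sound.py`, glue regenerated by
`pub-omega-tensor-g18/code/py/gen6_cert18.py`): with the replayed certificate (`MatMul22nRankGF7Slack6PatComplete`:
2 010 213-node interval-pruned search from 4 019 depth-11 states) the list of normalised slack-6 patterns is complete, every normalised slack-6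
pattern is a class representative moved by an element of `PGL₂(7)` (`MatMul22nRankGF7Slack6PatCert*`), hence every slack-6 pattern is
`repVal6 c ∘ omAct7 h` with `c < 3692`, `h < 336` (`slot_of_pat6`). Nothing here is progress on `ω`.
-/

namespace Summit.MatrixMultiplication.OmegaCensus.SmallFormats

open Finset

/-- **Every normalised slack-6 pattern is listed.** -/
theorem normList6_complete {P : ℕ → ℕ} (hP : IsPat7 6 P) (hN : IsNorm7 P) : ∃ n < 28590, ∀ z < 42, P z = normVal6 n z := by
  have hm := pcover5_sound (s := 6) (mem := normMem6) le_rfl (by norm_num) (by norm_num) preach6_all hP hN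
  obtain ⟨n, hn, hpk⟩ := normMem6_sound hm
  refine ⟨n, hn, fun z hz => ?_⟩
  unfold normVal6
  rw [hpk, fld_packP5 (s := 6) le_rfl hP.1 hz]

/-- Certificates for all `n < 28590`. -/
theorem normCert6_ok {n : ℕ} (hn : n < 28590) : normCls6 n < 3692 ∧ normElt6 n < 336 ∧
    ∀ z < 42, normVal6 n z = repVal6 (normCls6 n) (omAct7 (normElt6 n) z) := by
  have h : normCls6 n < 3692 ∧ normElt6 n < 336 ∧ ∀ z : Fin 42, normVal6 n z.val = repVal6 (normCls6 n) (omAct7 (normElt6 n) z.val) := by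
    by_cases h1 : n < 2048
    · rw [show n = 0 + (n - 0) by omega]; exact normCert6_ok_1 ⟨n - 0, by omega⟩
    by_cases h2 : n < 4096
    · rw [show n = 2048 + (n - 2048) by omega]; exact normCert6_ok_2 ⟨n - 2048, by omega⟩
    by_cases h3 : n < 6144
    · rw [show n = 4096 + (n - 4096) by omega]; exact normCert6_ok_3 ⟨n - 4096, by omega⟩
    by_cases h4 : n < 8192
    · rw [show n = 6144 + (n - 6144) by omega]; exact normCert6_ok_4 ⟨n - 6144, by omega⟩
    by_cases h5 : n < 10240
    · rw [show n = 8192 + (n - 8192) by omega]; exact normCert6_ok_5 ⟨n - 8192, by omega⟩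
    by_cases h6 : n < 12288
    · rw [show n = 10240 + (n - 10240) by omega]; exact normCert6_ok_6 ⟨n - 10240, by omega⟩
    by_cases h7 : n < 14336
    · rw [show n = 12288 + (n - 12288) by omega]; exact normCert6_ok_7 ⟨n - 12288, by omega⟩
    by_cases h8 : n < 16384
    · rw [show n = 14336 + (n - 14336) by omega]; exact normCert6_ok_8 ⟨n - 14336, by omega⟩
    by_cases h9 : n < 18432
    · rw [show n = 16384 + (n - 16384) by omega]; exact normCert6_ok_9 ⟨n - 16384, by omega⟩
    by_cases h10 : n < 20480
    · rw [show n = 18432 + (n - 18432) by omega]; exact normCert6_ok_10 ⟨n - 18432, by omega⟩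
    by_cases h11 : n < 22528
    · rw [show n = 20480 + (n - 20480) by omega]; exact normCert6_ok_11 ⟨n - 20480, by omega⟩
    by_cases h12 : n < 24576
    · rw [show n = 22528 + (n - 22528) by omega]; exact normCert6_ok_12 ⟨n - 22528, by omega⟩
    by_cases h13 : n < 26624
    · rw [show n = 24576 + (n - 24576) by omega]; exact normCert6_ok_13 ⟨n - 24576, by omega⟩
    rw [show n = 26624 + (n - 26624) by omega]; exact normCert6_ok_14 ⟨n - 26624, by omega⟩
  exact ⟨h.1, h.2.1, fun z hz => h.2.2 ⟨z, hz⟩⟩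

/-- **Every normalised slack-6 pattern is a class representative moved by an element of `PGL₂(7)`** (element and word form). -/
theorem norm_pattern_rep6 {P : ℕ → ℕ} (hP : IsPat7 6 P) (hN : IsNorm7 P) :
    ∃ c < 3692, ∃ h < 336, (∀ z < 42, P z = repVal6 c (omAct7 h z)) ∧ ∀ z < 42, P z = repVal6 c (lmulOmW7 (omWord7 h) z) := by
  obtain ⟨n, hn, hPn⟩ := normList6_complete hP hN
  obtain ⟨hc, hh, hval⟩ := normCert6_ok hn
  obtain ⟨hw, hact⟩ := omAct7_ok ⟨normElt6 n, hh⟩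
  refine ⟨normCls6 n, hc, normElt6 n, hh, fun z hz => by rw [hPn z hz, hval z hz], fun z hz => ?_⟩
  rw [hPn z hz, hval z hz]
  have e : omAct7 (normElt6 n) z = lmulOmW7 (omWord7 (normElt6 n)) z := (hact ⟨z, hz⟩).1
  rw [e]

/-- **Slot decomposition.** Every slack-6 pattern is `repVal6 c ∘ omAct7 h` for some class `c < 3692` and element `h < 336`. -/
theorem slot_of_pat6 {P : ℕ → ℕ} (hP : IsPat7 6 P) : ∃ c < 3692, ∃ h < 336, ∀ z < 42, P z = repVal6 c (omAct7 h z) := by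
  obtain ⟨W, hW, hN⟩ := exists_norm_fun7 P
  have hPW : IsPat7 6 (fun z => P (lmulOmW7 W z)) := isPat7_comp W hW hP
  obtain ⟨c, hc, h, hh, _, hval⟩ := norm_pattern_rep6 hPW hN
  obtain ⟨hw, _⟩ := omAct7_ok ⟨h, hh⟩
  obtain ⟨h', hh', hact⟩ := word_is_elem7 (omWord7 h ++ invWord7 W) (by
    intro k hk; rw [List.mem_append] at hk
    rcases hk with hk | hk
    · exact hw k hk
    · exact invWord7_letters hW k hk)
  refine ⟨c, hc, h', hh', fun z hz => ?_⟩
  have hz' : lmulOmW7 (invWord7 W) z < 42 := lmulOmW7_lt (invWord7_letters hW) hz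
  have e1 : P z = P (lmulOmW7 W (lmulOmW7 (invWord7 W) z)) := by rw [word_inv7 hW hz]
  rw [e1, hval _ hz', ← lmulOmW7_append, hact z hz]

set_option maxRecDepth 100000 in
set_option maxHeartbeats 40000000 in
/-- Representative values are `≤ 6`. -/
theorem repVal6_le : ∀ c : Fin 3692, ∀ z : Fin 42, repVal6 c.val z.val ≤ 6 := by decide +kernel

end Summit.MatrixMultiplication.OmegaCensus.SmallFormats
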